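/-
Copyright (c) 2026 the pub-hodgecm-mathlib formalisation cell (harness21).  Prover seat hodgecm-mathlib-K2E1-p13 (g5), Track B ∕ K2-LIT, h413 = `stmt-HodgeConjecture-24833`,
R90-TF section S8 «ContSpec-n½», S8 dealer R90-CS-plan (g3) S8-R192 ∕ S8-R203 (∞-2) «GENERAL BLOCKS: THE SHIFTED WITNESS», census `R90/S8/CENSUS-ArchSectionShiftedU3.K2E1-p13-g5.md`
51c4844f2a91ac38 — file (γ1): the ONE-VARIABLE ANALYSIS of the shifted archimedean kernel, `∫_ℝ (2+ζ)^p ∕ (ζ·ζ̄^{p+2}) dt = (−1)^{p+1}·π ∕ (2·A^{p+2}·|β|)` EXACTLY (`ζ = −A + iβt`).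
-/
import Summits.HodgeConjecture.HodgeConjecture.Theorems.K2E1ChiArchBetaNonvanishingU3   -- ★ (a-6) R90-CS-p03: `base_pos`, `integrable_base_rpow_neg` (the base `A² + B²s²`)
import Literature.Analysis.SpecialFunctions.InvAddSqPowIntegrals                        -- ★ `integral_univ_inv_add_sq_pow` (`∫ ((w + x²)ⁿ)⁻¹`)
import HarnessLib

/-!
# K2·E1 ∕ R90·S8 — `K2E1ChiArchShiftedKernelIntegralU3` (file (γ1) of (∞-2)): THE SHIFTED ARCHIMEDEAN KERNEL IN CLOSED FORM —
# `∫_ℝ (2 + ζ)^p ∕ (ζ·ζ̄^{p+2}) dt = (−1)^{p+1}·π ∕ (2·A^{p+2}·|β|)`, `ζ = −A + iβt`, `ζ̄ = −A − iβt`, every `p ∈ ℕ`, `A ≥ 1`, `β ≠ 0`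

Cell `pub/hodgecm-mathlib`, crux h413 = `stmt-HodgeConjecture-24833`, route of record `HCCMUnconditional`; R90-TF section S8 «ContSpec-n½», road R2-χ₃ ((V)(iii) row `hA32 : A(3∕2) ≠ 0`
for GENERAL blocks, S8-R192 (∞-2)).  THEOREMS ONLY (no `def`, no `instance`, no notation, no named-fact hypothesis, no `sorry`; default heartbeats); lane
`--supports stmt-HodgeConjecture-24833 --as helper` (count-neutral).  Pure one-variable calculus: the per-place `t`-integral that the ★ (a-10) engine
`integral_integral_prodWeight_mul_arch_cpow_neg_ne_zero` needs for the SHIFTED weight `archUnitaryValue (2p+1) 0 ζ·((2+ζ)∕ζ)^p` of ★ p864245 `archSectionShifted` (file (γ2)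
`K2E1ChiArchShiftedNonvanishingU3` does the bridge `phase·twist·q^{−3∕2} = (2+ζ)^p∕(ζ ζ̄^{p+2})`, the rotated positivity and the HEAD).

THE MATHEMATICS (census §4; elementary, no Γ-functions).  With `ζ + ζ̄ = −2A` and `ζ·ζ̄ = A² + β²t² =: q`:
(i) `∫_ℝ dt∕ζ^{n+1} = 0` for `n ≥ 1` — `(ζ^n)⁻¹` is an antiderivative of `−nβi∕ζ^{n+1}` tending to `0` at `±∞` (Mathlib `integral_of_hasDerivAt_of_tendsto`);
(ii) `J_n := ∫ dt∕(ζ·ζ̄^{n+1}) = (−1)^n π ∕ ((2A)^n·A|β|)` — `J₀ = ∫ dt∕q = π∕(A|β|)` (arctan) and `1∕(ζζ̄) = −(1∕2A)(1∕ζ + 1∕ζ̄)` gives `J_{n+1} = −J_n∕(2A) + 0` by (i) at `−β`;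
(iii) `K_{p,n} := ∫ (2+ζ)^p∕(ζ·ζ̄^n)` (`n ≥ p+2`, `A ≥ 1` for integrability `‖2+ζ‖ ≤ ‖ζ‖`): `2 + ζ = −ζ̄ − (2A−2)` gives `K_{p+1,n} = −K_{p,n−1} − (2A−2)K_{p,n}`, whence
`K_{p,p+2+j} = (−1)^{p+1+j} 2^p π ∕ ((2A)^{p+1+j}·A|β|)` and **`K_{p,p+2} = (−1)^{p+1}π∕(2A^{p+2}|β|)`**.
* §1 letters: `conj_zeta`, `zeta_add_zetaBar`, `zeta_mul_zetaBar`, `norm_zeta`, `zeta_ne_zero`, `norm_inv_zeta_pow`.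
* §2 `hasDerivAt_inv_zeta_pow`; §2b `continuous_zeta`, `tendsto_norm_zeta`, `tendsto_inv_zeta_pow`, `integrable_inv_zeta_pow`, **`integral_inv_zeta_pow_succ`** (`= 0`).
* §3 `norm_inv_zeta_mul_zetaBar_pow`, `integrable_inv_zeta_mul_zetaBar_pow`, `integral_inv_zeta_mul_zetaBar` (`J₀`), `inv_mul_pow_succ_eq`, `inv_zeta_mul_zetaBar_pow_succ`,
  **`integral_inv_zeta_mul_zetaBar_pow`** (`J_n`).
* §4 `two_add_zeta`, `two_add_zeta_eq_neg`, **`norm_two_add_zeta_le`**, `integrable_shiftKernel`, `neg_sub_pow_succ_mul_inv`, **`integral_shiftKernel`** (`K_{p,p+2+j}`),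
  **`integral_shiftKernel_zero`** (`K_{p,p+2}`).
HONEST LABEL: HC_CM is proved only modulo the 7 printed citations (2 remaining named inputs: hLiu418 = `stmt-HodgeConjecture-24832`, h413 = `stmt-HodgeConjecture-24833`) until
rung 0 closes; REL ≠ ★ ≠ BUILT; this file asserts no named fact and closes no socket; unconditional real∕complex analysis; count-neutral.

## References
* [GradshteynRyzhik2015] I. S. Gradshteyn, I. M. Ryzhik, *Table of Integrals, Series, and Products*, 8th ed. (2015): 2.148.4, 3.249.1.
* [Titchmarsh1939] E. C. Titchmarsh, *The Theory of Functions*, 2nd ed. (1939): §1.8 (integrals depending on a parameter, absolute convergence).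
-/

set_option autoImplicit false
set_option linter.dupNamespace false -- the mandated namespace repeats `HodgeConjecture.HodgeConjecture`

noncomputable section

open MeasureTheory Filter Set
open scoped Topology ComplexConjugate
open Summit.HodgeConjecture.HodgeConjecture.Cruxes.H413.K2E1ChiArchBetaNonvanishingU3 (base_pos integrable_base_rpow_neg)

namespace Summit.HodgeConjecture.HodgeConjecture.Cruxes.H413.K2E1ChiArchShiftedKernelIntegralU3

/-! ## §1 The letters `ζ = −A + iβs`, `ζ̄ = −A − iβs`: algebra and norms -/

section Letters

variable {A β : ℝ}

/-- `conj ζ(A, β, s) = ζ(A, −β, s)`. [folklore] -/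
theorem conj_zeta (A β s : ℝ) :
    conj ((((-A) : ℝ) : ℂ) + ((β * s : ℝ) : ℂ) * Complex.I) = (((-A) : ℝ) : ℂ) + (((-β) * s : ℝ) : ℂ) * Complex.I := by
  rw [map_add, map_mul, Complex.conj_ofReal, Complex.conj_ofReal, Complex.conj_I]
  push_cast
  ring

/-- `ζ + ζ̄ = −2A`. [folklore] -/
theorem zeta_add_zetaBar (A β s : ℝ) :
    ((((-A) : ℝ) : ℂ) + ((β * s : ℝ) : ℂ) * Complex.I) + ((((-A) : ℝ) : ℂ) + (((-β) * s : ℝ) : ℂ) * Complex.I) = -2 * (A : ℂ) := by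
  push_cast
  ring

/-- `ζ·ζ̄ = A² + β²s²` (as a real number cast to `ℂ`). [folklore] -/
theorem zeta_mul_zetaBar (A β s : ℝ) :
    ((((-A) : ℝ) : ℂ) + ((β * s : ℝ) : ℂ) * Complex.I) * ((((-A) : ℝ) : ℂ) + (((-β) * s : ℝ) : ℂ) * Complex.I) = ((A ^ 2 + β ^ 2 * s ^ 2 : ℝ) : ℂ) := by
  push_cast
  ring_nf
  rw [Complex.I_sq]
  ring

/-- `‖ζ(A, β, s)‖ = √(A² + β²s²)`. [folklore] -/
theorem norm_zeta (A β s : ℝ) : ‖(((-A) : ℝ) : ℂ) + ((β * s : ℝ) : ℂ) * Complex.I‖ = Real.sqrt (A ^ 2 + β ^ 2 * s ^ 2) := by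
  rw [Complex.norm_add_mul_I, neg_sq, mul_pow]

/-- `ζ ≠ 0` for `A ≠ 0` (`Re ζ = −A`). [folklore] -/
theorem zeta_ne_zero (hA : A ≠ 0) (β s : ℝ) : (((-A) : ℝ) : ℂ) + ((β * s : ℝ) : ℂ) * Complex.I ≠ 0 := by
  intro h
  have hre := congrArg Complex.re h
  simp at hre
  exact hA hre

/-- `‖(ζ^k)⁻¹‖ = (A² + β²s²)^{−k∕2}`. [folklore] -/
theorem norm_inv_zeta_pow (hA : 0 < A) (β s : ℝ) (k : ℕ) :
    ‖(((((-A) : ℝ) : ℂ) + ((β * s : ℝ) : ℂ) * Complex.I) ^ k)⁻¹‖ = (A ^ 2 + β ^ 2 * s ^ 2) ^ (-((k : ℝ) / 2)) := by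
  rw [norm_inv, norm_pow, norm_zeta]
  set q : ℝ := A ^ 2 + β ^ 2 * s ^ 2 with hq
  have hq0 : 0 ≤ q := (base_pos hA β s).le
  rw [Real.sqrt_eq_rpow, ← Real.rpow_natCast, ← Real.rpow_mul hq0, ← Real.rpow_neg hq0]
  congr 1
  ring

end Letters

/-! ## §2 `∫ ds ∕ ζ̄^{n+1} = 0` (`n ≥ 1`): an exact derivative vanishing at `±∞` -/

section Vanishing

variable {A β : ℝ}

/-- `d∕ds (ζ(A,β,s)^n)⁻¹ = −nβi ∕ ζ^{n+1}`. [folklore] -/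
theorem hasDerivAt_inv_zeta_pow (hA : A ≠ 0) (β : ℝ) (n : ℕ) (s : ℝ) :
    HasDerivAt (fun t : ℝ => (((((-A) : ℝ) : ℂ) + ((β * t : ℝ) : ℂ) * Complex.I) ^ n)⁻¹)
      (-((n : ℂ) * (β : ℂ) * Complex.I) / ((((-A) : ℝ) : ℂ) + ((β * s : ℝ) : ℂ) * Complex.I) ^ (n + 1)) s := by
  -- the complex polynomial `P(u) = −A + β·u·i` composed with `ofReal`
  have hP : ∀ u : ℂ, HasDerivAt (fun u : ℂ => ((((-A) : ℝ) : ℂ) + (β : ℂ) * u * Complex.I)) ((β : ℂ) * Complex.I) u := fun u => by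
    have h := ((hasDerivAt_id u).const_mul (β : ℂ)).mul_const Complex.I
    simpa using h.const_add ((((-A) : ℝ) : ℂ))
  have hz : ((((-A) : ℝ) : ℂ) + (β : ℂ) * (s : ℂ) * Complex.I) ≠ 0 := by
    have := zeta_ne_zero hA β s
    push_cast at this ⊢
    simpa [mul_assoc] using this
  have h1 := ((hP (s : ℂ)).pow n).inv (pow_ne_zero n hz)
  have h2 := h1.comp_ofReal
  have e : (fun t : ℝ => (((((-A) : ℝ) : ℂ) + ((β * t : ℝ) : ℂ) * Complex.I) ^ n)⁻¹) =
      fun y : ℝ => ((fun u : ℂ => ((((-A) : ℝ) : ℂ) + (β : ℂ) * u * Complex.I)) (y : ℂ) ^ n)⁻¹ := by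
    funext t
    push_cast
    ring_nf
  rw [e]
  refine h2.congr_deriv ?_
  have eq : ((((-A) : ℝ) : ℂ) + ((β * s : ℝ) : ℂ) * Complex.I) = ((((-A) : ℝ) : ℂ) + (β : ℂ) * (s : ℂ) * Complex.I) := by
    push_cast; ring
  rw [eq]
  simp only [Pi.pow_apply]
  rcases Nat.eq_zero_or_pos n with rfl | hn
  · simp
  · obtain ⟨k, rfl⟩ := Nat.exists_eq_succ_of_ne_zero hn.ne'
    simp only [Nat.succ_eq_add_one, Nat.add_sub_cancel]
    have hz' : (-(A : ℂ) + (β : ℂ) * (s : ℂ) * Complex.I) ≠ 0 := by push_cast at hz; exact hz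
    push_cast
    field_simp
    ring

end Vanishing

/-! ## §2b Decay, integrability, and the vanishing of `∫ ds ∕ ζ^{n+1}` -/

section Decay

variable {A β : ℝ}

/-- `t ↦ ζ(A, β, t)` is continuous. [folklore] -/
theorem continuous_zeta (A β : ℝ) : Continuous fun t : ℝ => ((((-A) : ℝ) : ℂ) + ((β * t : ℝ) : ℂ) * Complex.I) := by
  fun_prop

/-- `‖ζ(A,β,t)‖ → ∞` along any filter on which `|t| → ∞` (`|Im ζ| = |β|·|t| ≤ ‖ζ‖`). [folklore] -/
theorem tendsto_norm_zeta {l : Filter ℝ} (hl : Tendsto (fun t : ℝ => |t|) l atTop) (A : ℝ) (hβ : β ≠ 0) :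
    Tendsto (fun t : ℝ => ‖((((-A) : ℝ) : ℂ) + ((β * t : ℝ) : ℂ) * Complex.I)‖) l atTop := by
  refine tendsto_atTop_mono (fun t => ?_) (hl.const_mul_atTop (abs_pos.2 hβ))
  calc |β| * |t| = |(((((-A) : ℝ) : ℂ) + ((β * t : ℝ) : ℂ) * Complex.I)).im| := by simp [abs_mul]
    _ ≤ ‖((((-A) : ℝ) : ℂ) + ((β * t : ℝ) : ℂ) * Complex.I)‖ := Complex.abs_im_le_norm _

/-- `(ζ^n)⁻¹ → 0` as `|t| → ∞` (`n ≥ 1`). [folklore] -/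
theorem tendsto_inv_zeta_pow {l : Filter ℝ} (hl : Tendsto (fun t : ℝ => |t|) l atTop) (A : ℝ) (hβ : β ≠ 0) {n : ℕ} (hn : n ≠ 0) :
    Tendsto (fun t : ℝ => (((((-A) : ℝ) : ℂ) + ((β * t : ℝ) : ℂ) * Complex.I) ^ n)⁻¹) l (𝓝 0) := by
  rw [tendsto_zero_iff_norm_tendsto_zero]
  simp_rw [norm_inv, norm_pow]
  exact ((tendsto_pow_atTop hn).comp (tendsto_norm_zeta hl A hβ)).inv_tendsto_atTop

/-- `(ζ^k)⁻¹ ∈ L¹(ℝ)` for `k ≥ 2` (`‖·‖ = (A² + β²t²)^{−k∕2}`, ★ (a-6) `integrable_base_rpow_neg`). [cite: Titchmarsh1939, §1.8] -/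
theorem integrable_inv_zeta_pow (hA : 0 < A) (hβ : β ≠ 0) {k : ℕ} (hk : 2 ≤ k) : Integrable fun t : ℝ => (((((-A) : ℝ) : ℂ) + ((β * t : ℝ) : ℂ) * Complex.I) ^ k)⁻¹ := by
  have hc : Continuous fun t : ℝ => (((((-A) : ℝ) : ℂ) + ((β * t : ℝ) : ℂ) * Complex.I) ^ k)⁻¹ :=
    ((continuous_zeta A β).pow k).inv₀ fun t => pow_ne_zero _ (zeta_ne_zero hA.ne' β t)
  have hk' : (1 : ℝ) / 2 < (k : ℝ) / 2 := by
    have : (2 : ℝ) ≤ k := by exact_mod_cast hk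
    linarith
  refine (integrable_base_rpow_neg hA hβ hk').mono' hc.aestronglyMeasurable (Eventually.of_forall fun t => ?_)
  rw [norm_inv_zeta_pow hA]

/-- **`∫_ℝ dt ∕ ζ(A,β,t)^{n+1} = 0` for `n ≥ 1`** — `(ζ^n)⁻¹` is an antiderivative of `−nβi∕ζ^{n+1}` vanishing at `±∞`. [cite: Titchmarsh1939, §1.8] -/
theorem integral_inv_zeta_pow_succ (hA : 0 < A) (hβ : β ≠ 0) {n : ℕ} (hn : n ≠ 0) : ∫ t : ℝ, (((((-A) : ℝ) : ℂ) + ((β * t : ℝ) : ℂ) * Complex.I) ^ (n + 1))⁻¹ = 0 := by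
  have hI : Integrable fun t : ℝ => (((((-A) : ℝ) : ℂ) + ((β * t : ℝ) : ℂ) * Complex.I) ^ (n + 1))⁻¹ := integrable_inv_zeta_pow hA hβ (by omega)
  have hc : -((n : ℂ) * (β : ℂ) * Complex.I) ≠ 0 :=
    neg_ne_zero.2 (mul_ne_zero (mul_ne_zero (Nat.cast_ne_zero.2 hn) (Complex.ofReal_ne_zero.2 hβ)) Complex.I_ne_zero)
  have e : (fun t : ℝ => -((n : ℂ) * (β : ℂ) * Complex.I) / ((((-A) : ℝ) : ℂ) + ((β * t : ℝ) : ℂ) * Complex.I) ^ (n + 1)) = fun t : ℝ => -((n : ℂ) * (β : ℂ) * Complex.I) * (((((-A) : ℝ) : ℂ) + ((β * t : ℝ) : ℂ) * Complex.I) ^ (n + 1))⁻¹ := by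
    funext t
    rw [div_eq_mul_inv]
  have h := integral_of_hasDerivAt_of_tendsto (fun t => hasDerivAt_inv_zeta_pow hA.ne' β n t) (by rw [e]; exact hI.const_mul _)
    (tendsto_inv_zeta_pow tendsto_abs_atBot_atTop A hβ hn) (tendsto_inv_zeta_pow tendsto_abs_atTop_atTop A hβ hn)
  rw [e, integral_const_mul, sub_zero] at h
  exact (mul_eq_zero.1 h).resolve_left hc

end Decay

/-! ## §3 `J_n := ∫_ℝ dt ∕ (ζ·ζ̄^{n+1}) = (−1∕(2A))^n · π∕(A|β|)` -/

section J

variable {A β : ℝ}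

/-- `‖(ζ·ζ̄^k)⁻¹‖ = (A² + β²t²)^{−(k+1)∕2}`. [folklore] -/
theorem norm_inv_zeta_mul_zetaBar_pow (hA : 0 < A) (β t : ℝ) (k : ℕ) :
    ‖(((((-A) : ℝ) : ℂ) + ((β * t : ℝ) : ℂ) * Complex.I) * ((((-A) : ℝ) : ℂ) + (((-β) * t : ℝ) : ℂ) * Complex.I) ^ k)⁻¹‖ = (A ^ 2 + β ^ 2 * t ^ 2) ^ (-(((k : ℝ) + 1) / 2)) := by
  rw [norm_inv, norm_mul, norm_pow, norm_zeta, norm_zeta, neg_sq, ← pow_succ']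
  set q : ℝ := A ^ 2 + β ^ 2 * t ^ 2 with hq
  have hq0 : 0 ≤ q := (base_pos hA β t).le
  rw [Real.sqrt_eq_rpow, ← Real.rpow_natCast, ← Real.rpow_mul hq0, ← Real.rpow_neg hq0]
  congr 1
  push_cast
  ring

/-- `(ζ·ζ̄^k)⁻¹ ∈ L¹(ℝ)` for `k ≥ 1`. [cite: Titchmarsh1939, §1.8] -/
theorem integrable_inv_zeta_mul_zetaBar_pow (hA : 0 < A) (hβ : β ≠ 0) {k : ℕ} (hk : 1 ≤ k) : Integrable fun t : ℝ => (((((-A) : ℝ) : ℂ) + ((β * t : ℝ) : ℂ) * Complex.I) * ((((-A) : ℝ) : ℂ) + (((-β) * t : ℝ) : ℂ) * Complex.I) ^ k)⁻¹ := by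
  have hc : Continuous fun t : ℝ => (((((-A) : ℝ) : ℂ) + ((β * t : ℝ) : ℂ) * Complex.I) * ((((-A) : ℝ) : ℂ) + (((-β) * t : ℝ) : ℂ) * Complex.I) ^ k)⁻¹ :=
    ((continuous_zeta A β).mul ((continuous_zeta A (-β)).pow k)).inv₀ fun t =>
      mul_ne_zero (zeta_ne_zero hA.ne' β t) (pow_ne_zero _ (zeta_ne_zero hA.ne' (-β) t))
  have hk' : (1 : ℝ) / 2 < ((k : ℝ) + 1) / 2 := by
    have : (1 : ℝ) ≤ k := by exact_mod_cast hk
    linarith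
  refine (integrable_base_rpow_neg hA hβ hk').mono' hc.aestronglyMeasurable (Eventually.of_forall fun t => ?_)
  rw [norm_inv_zeta_mul_zetaBar_pow hA]

/-- **`J₀`: `∫_ℝ dt ∕ (ζ·ζ̄) = ∫ dt∕(A² + β²t²) = π ∕ (A·|β|)`** (Mathlib `integral_univ_inv_one_add_sq` after `t ↦ βt∕A`). [cite: GradshteynRyzhik2015, 2.148.4] -/
theorem integral_inv_zeta_mul_zetaBar (hA : 0 < A) (hβ : β ≠ 0) : ∫ t : ℝ, (((((-A) : ℝ) : ℂ) + ((β * t : ℝ) : ℂ) * Complex.I) * ((((-A) : ℝ) : ℂ) + (((-β) * t : ℝ) : ℂ) * Complex.I))⁻¹ = ((Real.pi / (A * |β|) : ℝ) : ℂ) := by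
  have e : (fun t : ℝ => (((((-A) : ℝ) : ℂ) + ((β * t : ℝ) : ℂ) * Complex.I) * ((((-A) : ℝ) : ℂ) + (((-β) * t : ℝ) : ℂ) * Complex.I))⁻¹) = fun t : ℝ => (((A ^ 2 + (β * t) ^ 2)⁻¹ : ℝ) : ℂ) := by
    funext t
    rw [zeta_mul_zetaBar, ← Complex.ofReal_inv, mul_pow]
  rw [e, integral_complex_ofReal]
  congr 1
  have h1 := Measure.integral_comp_mul_left (fun y : ℝ => (A ^ 2 + y ^ 2)⁻¹) β
  have h2 := Literature.Analysis.SpecialFunctions.integral_univ_inv_add_sq_pow (pow_pos hA 2) 1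
  simp only [pow_one] at h2
  rw [integral_univ_inv_one_add_sq, Real.sqrt_sq hA.le] at h2
  rw [h1, h2, smul_eq_mul, abs_inv]
  field_simp

/-- Pure algebra: `c·(z + w) = 1` ⇒ `(z·w^{n+2})⁻¹ = c·((z·w^{n+1})⁻¹ + (w^{n+2})⁻¹)`. [folklore] -/
theorem inv_mul_pow_succ_eq {z w c : ℂ} (hz : z ≠ 0) (hw : w ≠ 0) (hc : c * (z + w) = 1) (n : ℕ) :
    (z * w ^ (n + 2))⁻¹ = c * ((z * w ^ (n + 1))⁻¹ + (w ^ (n + 2))⁻¹) := by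
  have e1 : (z * w ^ (n + 1))⁻¹ = w * (z * w ^ (n + 2))⁻¹ := by
    field_simp
    ring
  have e2 : (w ^ (n + 2))⁻¹ = z * (z * w ^ (n + 2))⁻¹ := by
    field_simp
  rw [e1, e2, ← add_mul, ← mul_assoc, add_comm w z, hc, one_mul]

/-- The pointwise recursion `(ζ·ζ̄^{n+2})⁻¹ = (−1∕(2A))·((ζ·ζ̄^{n+1})⁻¹ + (ζ̄^{n+2})⁻¹)` (`ζ + ζ̄ = −2A`). [folklore] -/
theorem inv_zeta_mul_zetaBar_pow_succ (hA : A ≠ 0) (β t : ℝ) (n : ℕ) :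
    (((((-A) : ℝ) : ℂ) + ((β * t : ℝ) : ℂ) * Complex.I) * ((((-A) : ℝ) : ℂ) + (((-β) * t : ℝ) : ℂ) * Complex.I) ^ (n + 2))⁻¹ = (((-1 / (2 * A)) : ℝ) : ℂ) * ((((((-A) : ℝ) : ℂ) + ((β * t : ℝ) : ℂ) * Complex.I) * ((((-A) : ℝ) : ℂ) + (((-β) * t : ℝ) : ℂ) * Complex.I) ^ (n + 1))⁻¹ + (((((-A) : ℝ) : ℂ) + (((-β) * t : ℝ) : ℂ) * Complex.I) ^ (n + 2))⁻¹) := by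
  refine inv_mul_pow_succ_eq (zeta_ne_zero hA β t) (zeta_ne_zero hA (-β) t) ?_ n
  rw [zeta_add_zetaBar]
  have hA' : (A : ℂ) ≠ 0 := Complex.ofReal_ne_zero.2 hA
  push_cast
  field_simp

/-- **`J_n = (−1∕(2A))^n · π∕(A|β|)`**: `∫_ℝ dt ∕ (ζ·ζ̄^{n+1}) = (−1∕(2A))^n·π∕(A·|β|)` (induction: §2b kills `∫ ζ̄^{−(n+2)}`). [cite: GradshteynRyzhik2015, 2.148.4] -/
theorem integral_inv_zeta_mul_zetaBar_pow (hA : 0 < A) (hβ : β ≠ 0) (n : ℕ) :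
    ∫ t : ℝ, (((((-A) : ℝ) : ℂ) + ((β * t : ℝ) : ℂ) * Complex.I) * ((((-A) : ℝ) : ℂ) + (((-β) * t : ℝ) : ℂ) * Complex.I) ^ (n + 1))⁻¹ = ((((-1 : ℝ) ^ n * Real.pi / ((2 * A) ^ n * (A * |β|))) : ℝ) : ℂ) := by
  induction n with
  | zero =>
    simp only [zero_add, pow_one, pow_zero, one_mul]
    exact integral_inv_zeta_mul_zetaBar hA hβ
  | succ n ih =>
    have e : (fun t : ℝ => (((((-A) : ℝ) : ℂ) + ((β * t : ℝ) : ℂ) * Complex.I) * ((((-A) : ℝ) : ℂ) + (((-β) * t : ℝ) : ℂ) * Complex.I) ^ (n + 1 + 1))⁻¹) =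
        fun t : ℝ => (((-1 / (2 * A)) : ℝ) : ℂ) * ((((((-A) : ℝ) : ℂ) + ((β * t : ℝ) : ℂ) * Complex.I) * ((((-A) : ℝ) : ℂ) + (((-β) * t : ℝ) : ℂ) * Complex.I) ^ (n + 1))⁻¹ + (((((-A) : ℝ) : ℂ) + (((-β) * t : ℝ) : ℂ) * Complex.I) ^ (n + 2))⁻¹) := by
      funext t
      exact inv_zeta_mul_zetaBar_pow_succ hA.ne' β t n
    rw [e, integral_const_mul, integral_add (integrable_inv_zeta_mul_zetaBar_pow hA hβ (by omega))
      (integrable_inv_zeta_pow hA (neg_ne_zero.2 hβ) (by omega)), ih,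
      integral_inv_zeta_pow_succ hA (neg_ne_zero.2 hβ) (n := n + 1) (by omega), add_zero, ← Complex.ofReal_mul]
    congr 1
    have hA' : A ≠ 0 := hA.ne'
    have hβ' : |β| ≠ 0 := abs_ne_zero.2 hβ
    rw [div_mul_div_comm, pow_succ, pow_succ]
    field_simp

end J

/-! ## §4 `K_{p,n} := ∫_ℝ (2+ζ)^p ∕ (ζ·ζ̄^n) dt = 2^p·J` (`n ≥ p+2`, `A ≥ 1`): the shifted kernels -/

section K

variable {A β : ℝ}

/-- `2 + ζ = (2 − A) + iβt`. [folklore] -/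
theorem two_add_zeta (A β t : ℝ) : (2 : ℂ) + ((((-A) : ℝ) : ℂ) + ((β * t : ℝ) : ℂ) * Complex.I) = (((2 - A) : ℝ) : ℂ) + ((β * t : ℝ) : ℂ) * Complex.I := by
  push_cast
  ring

/-- `2 + ζ = −ζ̄ − (2A − 2)`. [folklore] -/
theorem two_add_zeta_eq_neg (A β t : ℝ) : (2 : ℂ) + ((((-A) : ℝ) : ℂ) + ((β * t : ℝ) : ℂ) * Complex.I) = -((((-A) : ℝ) : ℂ) + (((-β) * t : ℝ) : ℂ) * Complex.I) - (((2 * A - 2) : ℝ) : ℂ) := by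
  push_cast
  ring

/-- **`‖2 + ζ‖ ≤ ‖ζ‖` when `A ≥ 1`** (`(2 − A)² ≤ A²`): the twist `(2+ζ)∕ζ` has modulus `≤ 1` on the big cell. [folklore] -/
theorem norm_two_add_zeta_le (hA : 1 ≤ A) (β t : ℝ) : ‖(2 : ℂ) + ((((-A) : ℝ) : ℂ) + ((β * t : ℝ) : ℂ) * Complex.I)‖ ≤ ‖((((-A) : ℝ) : ℂ) + ((β * t : ℝ) : ℂ) * Complex.I)‖ := by
  rw [two_add_zeta, Complex.norm_add_mul_I, norm_zeta, mul_pow]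
  exact Real.sqrt_le_sqrt (by nlinarith)

/-- `(2+ζ)^p ∕ (ζ·ζ̄^n) ∈ L¹(ℝ)` for `n ≥ p + 2`, `A ≥ 1` (`‖·‖ ≤ (A² + β²t²)^{−(n+1−p)∕2}`). [cite: Titchmarsh1939, §1.8] -/
theorem integrable_shiftKernel (hA : 1 ≤ A) (hβ : β ≠ 0) {p n : ℕ} (hn : p + 2 ≤ n) :
    Integrable fun t : ℝ => ((2 : ℂ) + ((((-A) : ℝ) : ℂ) + ((β * t : ℝ) : ℂ) * Complex.I)) ^ p * (((((-A) : ℝ) : ℂ) + ((β * t : ℝ) : ℂ) * Complex.I) * ((((-A) : ℝ) : ℂ) + (((-β) * t : ℝ) : ℂ) * Complex.I) ^ n)⁻¹ := by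
  have hA0 : 0 < A := by linarith
  have hc : Continuous fun t : ℝ => ((2 : ℂ) + ((((-A) : ℝ) : ℂ) + ((β * t : ℝ) : ℂ) * Complex.I)) ^ p * (((((-A) : ℝ) : ℂ) + ((β * t : ℝ) : ℂ) * Complex.I) * ((((-A) : ℝ) : ℂ) + (((-β) * t : ℝ) : ℂ) * Complex.I) ^ n)⁻¹ :=
    ((continuous_const.add (continuous_zeta A β)).pow p).mul
      (((continuous_zeta A β).mul ((continuous_zeta A (-β)).pow n)).inv₀ fun t =>
        mul_ne_zero (zeta_ne_zero hA0.ne' β t) (pow_ne_zero _ (zeta_ne_zero hA0.ne' (-β) t)))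
  have ha : (1 : ℝ) / 2 < (((n : ℝ) + 1 - p) / 2) := by
    have : (p : ℝ) + 2 ≤ n := by exact_mod_cast hn
    linarith
  refine (integrable_base_rpow_neg hA0 hβ ha).mono' hc.aestronglyMeasurable (Eventually.of_forall fun t => ?_)
  rw [norm_mul, norm_pow, norm_inv_zeta_mul_zetaBar_pow hA0]
  set q : ℝ := A ^ 2 + β ^ 2 * t ^ 2 with hq
  have hq0 : 0 < q := base_pos hA0 β t
  have h1 : ‖(2 : ℂ) + ((((-A) : ℝ) : ℂ) + ((β * t : ℝ) : ℂ) * Complex.I)‖ ^ p ≤ q ^ ((p : ℝ) / 2) := by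
    calc ‖(2 : ℂ) + ((((-A) : ℝ) : ℂ) + ((β * t : ℝ) : ℂ) * Complex.I)‖ ^ p ≤ ‖((((-A) : ℝ) : ℂ) + ((β * t : ℝ) : ℂ) * Complex.I)‖ ^ p := pow_le_pow_left₀ (norm_nonneg _) (norm_two_add_zeta_le hA β t) p
      _ = q ^ ((p : ℝ) / 2) := by
        rw [norm_zeta, Real.sqrt_eq_rpow, ← Real.rpow_natCast, ← Real.rpow_mul hq0.le]
        congr 1
        ring
  calc ‖(2 : ℂ) + ((((-A) : ℝ) : ℂ) + ((β * t : ℝ) : ℂ) * Complex.I)‖ ^ p * q ^ (-(((n : ℝ) + 1) / 2)) ≤ q ^ ((p : ℝ) / 2) * q ^ (-(((n : ℝ) + 1) / 2)) :=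
        mul_le_mul_of_nonneg_right h1 (Real.rpow_nonneg hq0.le _)
    _ = q ^ (-(((n : ℝ) + 1 - p) / 2)) := by
        rw [← Real.rpow_add hq0]
        congr 1
        ring

/-- Pure algebra: `(−w − d)^{p+1}∕(z·w^{n+1}) = −(−w − d)^p∕(z·w^n) − d·(−w − d)^p∕(z·w^{n+1})`. [folklore] -/
theorem neg_sub_pow_succ_mul_inv {z w : ℂ} (hz : z ≠ 0) (hw : w ≠ 0) (d : ℂ) (p n : ℕ) :
    (-w - d) ^ (p + 1) * (z * w ^ (n + 1))⁻¹ = -((-w - d) ^ p * (z * w ^ n)⁻¹) - d * ((-w - d) ^ p * (z * w ^ (n + 1))⁻¹) := by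
  rw [pow_succ]
  field_simp
  ring

/-- **`K_{p, p+2+j} = 2^p·(−1∕(2A))^{p+1+j}·π∕(A|β|)`**: `∫_ℝ (2+ζ)^p ∕ (ζ·ζ̄^{p+2+j}) dt` in closed form (induction on `p` via `2 + ζ = −ζ̄ − (2A−2)` and §3).
[cite: GradshteynRyzhik2015, 2.148.4] -/
theorem integral_shiftKernel (hA : 1 ≤ A) (hβ : β ≠ 0) (p j : ℕ) :
    ∫ t : ℝ, ((2 : ℂ) + ((((-A) : ℝ) : ℂ) + ((β * t : ℝ) : ℂ) * Complex.I)) ^ p * (((((-A) : ℝ) : ℂ) + ((β * t : ℝ) : ℂ) * Complex.I) * ((((-A) : ℝ) : ℂ) + (((-β) * t : ℝ) : ℂ) * Complex.I) ^ (p + 2 + j))⁻¹ =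
      ((((-1 : ℝ) ^ (p + 1 + j) * 2 ^ p * Real.pi / ((2 * A) ^ (p + 1 + j) * (A * |β|))) : ℝ) : ℂ) := by
  have hA0 : 0 < A := by linarith
  induction p generalizing j with
  | zero =>
    simp only [pow_zero, one_mul, zero_add]
    rw [show 2 + j = (j + 1) + 1 by ring, integral_inv_zeta_mul_zetaBar_pow hA0 hβ (j + 1)]
    congr 1
    rw [show 1 + j = j + 1 by ring]
    ring
  | succ p ih =>
    have e : (fun t : ℝ => ((2 : ℂ) + ((((-A) : ℝ) : ℂ) + ((β * t : ℝ) : ℂ) * Complex.I)) ^ (p + 1) * (((((-A) : ℝ) : ℂ) + ((β * t : ℝ) : ℂ) * Complex.I) * ((((-A) : ℝ) : ℂ) + (((-β) * t : ℝ) : ℂ) * Complex.I) ^ (p + 1 + 2 + j))⁻¹) =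
        fun t : ℝ => -(((2 : ℂ) + ((((-A) : ℝ) : ℂ) + ((β * t : ℝ) : ℂ) * Complex.I)) ^ p * (((((-A) : ℝ) : ℂ) + ((β * t : ℝ) : ℂ) * Complex.I) * ((((-A) : ℝ) : ℂ) + (((-β) * t : ℝ) : ℂ) * Complex.I) ^ (p + 2 + j))⁻¹) -
          (((2 * A - 2) : ℝ) : ℂ) * (((2 : ℂ) + ((((-A) : ℝ) : ℂ) + ((β * t : ℝ) : ℂ) * Complex.I)) ^ p * (((((-A) : ℝ) : ℂ) + ((β * t : ℝ) : ℂ) * Complex.I) * ((((-A) : ℝ) : ℂ) + (((-β) * t : ℝ) : ℂ) * Complex.I) ^ (p + 2 + (j + 1)))⁻¹) := by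
      funext t
      rw [show p + 1 + 2 + j = (p + 2 + j) + 1 by ring, show p + 2 + (j + 1) = (p + 2 + j) + 1 by ring, two_add_zeta_eq_neg]
      exact neg_sub_pow_succ_mul_inv (zeta_ne_zero hA0.ne' β t) (zeta_ne_zero hA0.ne' (-β) t) _ p (p + 2 + j)
    have hi1 : Integrable fun t : ℝ => -(((2 : ℂ) + ((((-A) : ℝ) : ℂ) + ((β * t : ℝ) : ℂ) * Complex.I)) ^ p * (((((-A) : ℝ) : ℂ) + ((β * t : ℝ) : ℂ) * Complex.I) * ((((-A) : ℝ) : ℂ) + (((-β) * t : ℝ) : ℂ) * Complex.I) ^ (p + 2 + j))⁻¹) :=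
      (integrable_shiftKernel hA hβ (p := p) (n := p + 2 + j) (by omega)).neg
    have hi2 : Integrable fun t : ℝ => (((2 * A - 2) : ℝ) : ℂ) * (((2 : ℂ) + ((((-A) : ℝ) : ℂ) + ((β * t : ℝ) : ℂ) * Complex.I)) ^ p * (((((-A) : ℝ) : ℂ) + ((β * t : ℝ) : ℂ) * Complex.I) * ((((-A) : ℝ) : ℂ) + (((-β) * t : ℝ) : ℂ) * Complex.I) ^ (p + 2 + (j + 1)))⁻¹) :=
      (integrable_shiftKernel hA hβ (p := p) (n := p + 2 + (j + 1)) (by omega)).const_mul _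
    rw [e, integral_sub hi1 hi2, integral_neg, integral_const_mul, ih j, ih (j + 1), ← Complex.ofReal_neg, ← Complex.ofReal_mul,
      ← Complex.ofReal_sub]
    congr 1
    have hA' : A ≠ 0 := hA0.ne'
    have hβ' : |β| ≠ 0 := abs_ne_zero.2 hβ
    rw [show p + 1 + (j + 1) = (p + 1 + j) + 1 by ring, show p + 1 + 1 + j = (p + 1 + j) + 1 by ring, pow_succ, pow_succ,
      pow_succ]
    field_simp
    ring

/-- **THE SHIFTED KERNEL INTEGRAL**: `∫_ℝ (2+ζ)^p ∕ (ζ·ζ̄^{p+2}) dt = (−1)^{p+1}·π ∕ (2·A^{p+2}·|β|)` (`A ≥ 1`, `β ≠ 0`). [cite: GradshteynRyzhik2015, 2.148.4] -/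
theorem integral_shiftKernel_zero (hA : 1 ≤ A) (hβ : β ≠ 0) (p : ℕ) :
    ∫ t : ℝ, ((2 : ℂ) + ((((-A) : ℝ) : ℂ) + ((β * t : ℝ) : ℂ) * Complex.I)) ^ p * (((((-A) : ℝ) : ℂ) + ((β * t : ℝ) : ℂ) * Complex.I) * ((((-A) : ℝ) : ℂ) + (((-β) * t : ℝ) : ℂ) * Complex.I) ^ (p + 2))⁻¹ = ((((-1 : ℝ) ^ (p + 1) * Real.pi / (2 * A ^ (p + 2) * |β|)) : ℝ) : ℂ) := by
  have hA0 : 0 < A := by linarith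
  have h := integral_shiftKernel hA hβ p 0
  rw [add_zero, add_zero] at h
  rw [h]
  congr 1
  have hA' : A ≠ 0 := hA0.ne'
  have hβ' : |β| ≠ 0 := abs_ne_zero.2 hβ
  rw [mul_pow, pow_succ (2 : ℝ) p, show A ^ (p + 2) = A ^ (p + 1) * A by ring]
  field_simp

end K

end Summit.HodgeConjecture.HodgeConjecture.Cruxes.H413.K2E1ChiArchShiftedKernelIntegralU3

end
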